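import Summits.Ventures.CertifiedManyBodySolver.Rows.RectMarginalNodesSymTorus
import HarnessLib

/-!
# Square-lattice window-marginal nodes — module 8/9: RectMarginalNodesSymTransport

HONEST FRAMING: first certified bounds; not a superconductivity verdict; every number certified or labelled float.
SOUNDNESS / TRANSPORT statements only (inequalities between relaxations and finite-torus / thermodynamic-limit energies); no number is certified here.
THIS module: 7.4 (transport half) `LTIRectSymGSNodeTW.le_div_of_isSymTorusState`, `LTIRectSymGSNodeTW.le_groundEnergyAt_div` (L ≥ a+b+3, a,b ≥ 2, every N ≤ 2L²) and the corollaries `LTIRectSymGSNode.le_groundEnergyAt_div` / `LTIRectSymNode.le_groundEnergyAt_div`.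

FILING NOTE (sr-mbsolver-lit-4 g9, 2026-08-22): modules 5–9 `Rows/RectMarginalNodesTW.lean` → `…Sym.lean` → `…SymTorus.lean` → `…SymTransport.lean` → `…SymTL.lean`
continue parts 1–4 (`Rows/RectMarginalNodes.lean` … `Rows/RectMarginalNodesGS.lean`) and are sr-mbsolver-op-07 gen-12's PROVED HOME file
`HOME/sr-mbsolver-op-07/lean/RectMarginalNodes_v3.2.lean` (sha256 d4d4026ae96b32c5…, 2 279 lines, sorry-free, standard axioms; = v3.1 87fe4cef… with the §7.4 proof cut into
`IsSymTorusState` / `isSymTorusState_sectorGround` / `le_div_of_isSymTorusState`) §6b–§7 split per op-07's `FILING-MAP-v3.2.md` (one-writer rule; §8 not filed: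
content-duplicate of pub-hubbard #235 `HubbardAlg/GSWindowNodeD4Sound.lean`), namespace `…CertifiedManyBodySolver.Sketch2D` renamed `Summit.Ventures.CertifiedManyBodySolver.Rows.RectMarginalNodes`;
declarations, statements and proofs VERBATIM (9 one-line docstrings added for the gate's lint; modules 8/9 re-declare the §7.3 `variable {L : ℕ} [NeZero L]` and module 8
re-applies module 7's `DecidableEq (FermionTorus 2 L)` instance as a local instance of priority high (op-07 g13 advisories A1/A2 adopted: minimal imports, no pin in module 9).
-/

noncomputable section

open Matrix Complex Finset Filter Topology
open scoped ComplexOrder MatrixOrder BigOperators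
open Literature.Probability.LatticeModels
open Literature.MathematicalPhysics.QuantumLattice
open Literature.MathematicalPhysics.QuantumLattice.AndersonCluster
open Literature.MathematicalPhysics.QuantumLattice.HubbardWave0
open Literature.MathematicalPhysics.QuantumLattice.ThermodynamicLimit
open Literature.MathematicalPhysics.QuantumManyBody.StateRelaxation

namespace Summit.Ventures.CertifiedManyBodySolver.Rows.RectMarginalNodes

section SymTransport

variable {L : ℕ} [NeZero L]

-- Re-activate (locally, priority `high`) the §7.3 instance `instDecidableEqFermionTorusSketch : DecidableEq (FermionTorus 2 L) :=
-- LinearOrder.toDecidableEq` of module 7 (`Rows/RectMarginalNodesSymTorus.lean`), under which `TorusOp` / `IsSymTorusState` were elaborated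
-- (op-07 FILING-MAP-v3.2 §1: the declaration itself cannot be repeated — it is exported by module 7 — so the attribute is re-applied).
attribute [local instance 10000] instDecidableEqFermionTorusSketch

/-- **By-value transport, window half** (v3.1 steps (6)–(9), verbatim but for reading the torus rows from
`IsSymTorusState`): for `L ≥ 3`, `a + b + 3 ≤ L`, `a, b ≥ 2`, every torus functional `ω` with the rows
`IsSymTorusState t U hL N E ω` makes the window density matrix of its pull-back along `Γ(ι_{W,L})`, `W = [0,a) × [0,b)`,
feasible for `LTIRectSymGSNodeTW t U a b (N/L²)` — PSD / trace one; LTI, `p4m`, spin-flip rows from the invariances;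
block and `SU(2)` rows from the vanishing commutator expectations; densities; stability rows plain (`Λ⁺ ⊆ W`) and
TERM-WISE RELOCATED (§6b: `Λ ⊆ W`, translation or affine-`D₄` data; each relocated piece has the torus expectation of
the un-relocated one, `fermionEmbed_toTorusEmb_shiftEmb/_d4Emb`, and the pieces reassemble to `Γ(Ãᴴ[H_{Λ⁺}, Ã])`,
`hubbardTorus_commutator_fermionEmbed`, then the package's `stab`) — with objective `Re Tr ρ h_avg = E/L²`
(`WindowLTI.wfun_meanEnergyObs` + the §5/§7.2 bookkeeping); hence `lo ≤ E/L²`. -/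
theorem LTIRectSymGSNodeTW.le_div_of_isSymTorusState (t U : ℝ) (hL : 3 ≤ L) {a b : ℕ} (ha : 2 ≤ a) (hb : 2 ≤ b)
    (habL : a + b + 3 ≤ L) {N : ℕ} {E lo : ℝ} {ω : TorusOp L →ₗ[ℂ] ℂ} (hω : IsSymTorusState t U hL N E ω)
    (h : LTIRectSymGSNodeTW t U a b ((N : ℝ) / (L : ℝ) ^ 2) lo) : lo ≤ E / (L : ℝ) ^ 2 := by
  classical
  obtain ⟨hone, hpos, hωh, hconjT, hconjD, hconjS, hωN, hωSp, hωn, hE, hωstab⟩ := hω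
  have haL : a + 1 ≤ L := by omega
  have hbL : b + 1 ≤ L := by omega
  -- (6) the windows `W = [0,a) × [0,b)` and `W⁺ = [-1,1]² ∪ W`, their functionals and density matrices
  have hWp := injOn_proj_thicken_union_rectWindow hL haL hbL
  have hWsub : rectWindow a b ⊆ thicken ({0} : Finset (Site 2)) 1 ∪ rectWindow a b := Finset.subset_union_right
  have hth : thicken ({0} : Finset (Site 2)) 1 ⊆ thicken ({0} : Finset (Site 2)) 1 ∪ rectWindow a b :=
    Finset.subset_union_left
  have hWinj : Set.InjOn (Torus.proj (d := 2) L) ↑(rectWindow a b) := hWp.mono (by exact_mod_cast hWsub)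
  have hpair : ∀ i : Fin 2, ({0, 0 + unitVec i} : Finset (Site 2)) ⊆ rectWindow a b := pair_subset_rectWindow ha hb
  have hpair' : ∀ i : Fin 2, ({0, 0 + unitVec i} : Finset (Site 2)) ⊆ thicken ({0} : Finset (Site 2)) 1 ∪ rectWindow a b :=
    fun i => (hpair i).trans hWsub
  set φ := torusWindowFun ω hWinj with hφdef
  set φp := torusWindowFun ω hWp with hφpdef
  have hφ : ∀ Y, φ Y = ω (fermionEmbed (PolySite.toTorusEmb L hWinj) Y) := fun Y => rfl
  have hφp : ∀ Y, φp Y = ω (fermionEmbed (PolySite.toTorusEmb L hWp) Y) := fun Y => rfl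
  set ρ := densityOfFun φ with hρdef
  set ρp := densityOfFun φp with hρpdef
  have hρLTI : WindowLTI ρ := windowLTI_densityOfFun_torusWindowFun ω hWinj hconjT
  have hρpLTI : WindowLTI ρp := windowLTI_densityOfFun_torusWindowFun ω hWp hconjT
  -- (7) the rows of `ρ`
  have hφh : ∀ Y, φ Yᴴ = star (φ Y) := fun Y => by
    rw [hφ, hφ, fermionEmbed_conjTranspose]
    exact hωh _
  have hρpsd : ρ.PosSemidef :=
    densityOfFun_posSemidef φ hφh fun C => by
      rw [hφ, map_mul, fermionEmbed_conjTranspose]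
      exact hpos _
  have hρtr : ρ.trace = 1 := by
    rw [← Matrix.mul_one ρ, hρdef, trace_densityOfFun_mul, hφ, map_one, hone]
  have hcW : ((rectWindow a b).card : ℂ) = (a : ℂ) * b := by exact_mod_cast card_rectWindow' a b
  have hspinC : ∀ σ : Fin 2, (ρ * ∑ y : PolySite (rectWindow a b), numberOp y σ).trace =
      (((a : ℝ) * b * (((N : ℝ) / 2) / (L : ℝ) ^ 2) : ℝ) : ℂ) := by
    intro σ
    rw [hρdef, trace_densityOfFun_mul, hφ, map_sum, map_sum]
    simp only [fermionEmbed_numberOp, PolySite.toTorusEmb_apply, hωn]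
    rw [Finset.sum_const, Finset.card_univ, card_polySite, nsmul_eq_mul, hcW,
      Literature.MathematicalPhysics.QuantumLattice.card_torusSite]
    push_cast
    ring
  have hspin : ∀ σ : Fin 2, ((ρ * ∑ y : PolySite (rectWindow a b), numberOp y σ).trace).re =
      ((a : ℝ) * b) * ((N : ℝ) / (L : ℝ) ^ 2 / 2) := by
    intro σ
    rw [hspinC, Complex.ofReal_re]
    ring
  have hdens : ((ρ * totalNumber).trace).re = ((a : ℝ) * b) * ((N : ℝ) / (L : ℝ) ^ 2) := by
    have e : (totalNumber : FermionOp (rectWindow a b)) =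
        ∑ σ : Fin 2, ∑ y : PolySite (rectWindow a b), numberOp y σ := by
      rw [totalNumber, Finset.sum_comm]
    rw [e, Matrix.mul_sum, Matrix.trace_sum]
    simp only [hspinC, Fin.sum_univ_two]
    rw [← Complex.ofReal_add, Complex.ofReal_re]
    ring
  have hcomm : ∀ (σ : Fin 2) (Y : FermionOp (rectWindow a b)),
      (ρ * ((∑ y : PolySite (rectWindow a b), numberOp y σ) * Y -
        Y * ∑ y : PolySite (rectWindow a b), numberOp y σ)).trace = 0 := by
    intro σ Y
    rw [hρdef, trace_densityOfFun_mul, hφ,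
      ← Summit.Ventures.CertifiedManyBodySolver.Transport.sum_numberOp_commutator_fermionEmbed]
    exact hωN σ _
  have hflip : WindowSpinFlip ρ := windowSpinFlip_densityOfFun_torusWindowFun ω hWinj hconjS
  have hsu2 : WindowSU2 ρ := windowSU2_densityOfFun_torusWindowFun ω hWinj hωSp
  have hp4m : WindowP4m ρ := windowP4m_densityOfFun_torusWindowFun ω hWinj hconjD
  have hstab : ∀ (Λ : Finset (Site 2)) (hΛ : thicken Λ 1 ⊆ rectWindow a b) (X : FermionOp Λ),
      Commute X totalNumber → 0 ≤ (ρ * fermionEmbed (PolySite.incl hΛ) (stabilityObs t U Λ X)).trace := by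
    intro Λ hΛ X hXN
    have hspread : ∀ x ∈ thicken Λ 1, ∀ y ∈ thicken Λ 1, ∀ j : Fin 2, |x j - y j| ≤ ((a + b : ℕ) : ℤ) := by
      intro x hx y hy
      have h1 := mem_rectWindow'.1 (hΛ hx)
      have h2 := mem_rectWindow'.1 (hΛ hy)
      rw [Fin.forall_fin_two, abs_le, abs_le]
      push_cast
      refine ⟨⟨?_, ?_⟩, ?_, ?_⟩ <;> omega
    have hInjΛ : Set.InjOn (Torus.proj (d := 2) L) ↑(thicken (thicken Λ 1) 1) :=
      injOn_proj_thicken_one_of_spread hspread (by omega)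
    have hΛinj : Set.InjOn (Torus.proj (d := 2) L) ↑Λ :=
      hInjΛ.mono (by exact_mod_cast (subset_thicken Λ 1).trans (subset_thicken (thicken Λ 1) 1))
    have hclosed : ∀ x ∈ Λ, ∀ i : Fin 2, x + unitVec i ∈ thicken Λ 1 ∧ x - unitVec i ∈ thicken Λ 1 :=
      fun x hx i => ⟨add_unitVec_mem_thicken_one hx i, sub_unitVec_mem_thicken_one hx i⟩
    have hrow : (ρ * fermionEmbed (PolySite.incl hΛ) (stabilityObs t U Λ X)).trace =
        ω (fermionEmbed (PolySite.toTorusEmb L (hInjΛ.mono (by exact_mod_cast subset_thicken (thicken Λ 1) 1)))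
          (stabilityObs t U Λ X)) := by
      rw [hρdef, trace_densityOfFun_mul, hφ, fermionEmbed_toTorusEmb_incl]
    rw [hrow, stabilityObs, fermionEmbed_mul, fermionEmbed_conjTranspose,
      ← hubbardTorus_commutator_fermionEmbed L t U (subset_thicken Λ 1) hclosed hInjΛ X]
    have hB : fermionEmbed (PolySite.toTorusEmb L (hInjΛ.mono (by exact_mod_cast subset_thicken (thicken Λ 1) 1)))
        (fermionEmbed (PolySite.incl (subset_thicken Λ 1)) X) = fermionEmbed (PolySite.toTorusEmb L hΛinj) X := by
      rw [fermionEmbed_fermionEmbed]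
      exact congrFun (congrArg DFunLike.coe (fermionEmbed_congr fun p => rfl)) X
    rw [hB]
    exact hωstab _ (commute_fermionEmbed_toTorusEmb_totalNumber L hΛinj hXN)
  -- (7b) TERM-WISE-RELOCATED stability rows (§6b), for boxes `Λ ⊆ W`: injectivity radius from `Λ ⊆ W`
  have hInjBox : ∀ Λ : Finset (Site 2), Λ ⊆ rectWindow a b →
      Set.InjOn (Torus.proj (d := 2) L) ↑(thicken (thicken Λ 1) 1) := by
    intro Λ hΛW
    have hspread0 : ∀ x ∈ Λ, ∀ y ∈ Λ, ∀ j : Fin 2, |x j - y j| ≤ ((a + b - 2 : ℕ) : ℤ) := by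
      intro x hx y hy
      have h1 := mem_rectWindow'.1 (hΛW hx)
      have h2 := mem_rectWindow'.1 (hΛW hy)
      have hab : ((a + b - 2 : ℕ) : ℤ) = (a : ℤ) + b - 2 := by omega
      rw [Fin.forall_fin_two, abs_le, abs_le, hab]
      refine ⟨⟨?_, ?_⟩, ?_, ?_⟩ <;> omega
    have hspread : ∀ x ∈ thicken Λ 1, ∀ y ∈ thicken Λ 1, ∀ j : Fin 2, |x j - y j| ≤ ((a + b : ℕ) : ℤ) := by
      intro x hx y hy j
      have e := abs_sub_le_of_mem_thicken_one hspread0 hx hy j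
      have hab : ((a + b - 2 : ℕ) : ℤ) + 2 = ((a + b : ℕ) : ℤ) := by omega
      rwa [hab] at e
    exact injOn_proj_thicken_one_of_spread hspread (by omega)
  -- the common tail: `0 ≤ ω(Γ(Ãᴴ[H_{Λ⁺}, Ã]))` for `Λ ⊆ W`, `A` commuting with `N_Λ`
  have htail : ∀ Λ : Finset (Site 2), ∀ hΛW : Λ ⊆ rectWindow a b, ∀ X : FermionOp Λ, Commute X totalNumber →
      0 ≤ ω (fermionEmbed (PolySite.toTorusEmb L
        ((hInjBox Λ hΛW).mono (by exact_mod_cast subset_thicken (thicken Λ 1) 1))) (stabilityObs t U Λ X)) := by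
    intro Λ hΛW X hXN
    have hInjΛ := hInjBox Λ hΛW
    have hΛinj : Set.InjOn (Torus.proj (d := 2) L) ↑Λ :=
      hInjΛ.mono (by exact_mod_cast (subset_thicken Λ 1).trans (subset_thicken (thicken Λ 1) 1))
    have hclosed : ∀ x ∈ Λ, ∀ i : Fin 2, x + unitVec i ∈ thicken Λ 1 ∧ x - unitVec i ∈ thicken Λ 1 :=
      fun x hx i => ⟨add_unitVec_mem_thicken_one hx i, sub_unitVec_mem_thicken_one hx i⟩
    rw [stabilityObs, fermionEmbed_mul, fermionEmbed_conjTranspose,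
      ← hubbardTorus_commutator_fermionEmbed L t U (subset_thicken Λ 1) hclosed hInjΛ X]
    have hB : fermionEmbed (PolySite.toTorusEmb L (hInjΛ.mono (by exact_mod_cast subset_thicken (thicken Λ 1) 1)))
        (fermionEmbed (PolySite.incl (subset_thicken Λ 1)) X) = fermionEmbed (PolySite.toTorusEmb L hΛinj) X := by
      rw [fermionEmbed_fermionEmbed]
      exact congrFun (congrArg DFunLike.coe (fermionEmbed_congr fun p => rfl)) X
    rw [hB]
    exact hωstab _ (commute_fermionEmbed_toTorusEmb_totalNumber L hΛinj hXN)
  have hstabTW : ∀ Λ : Finset (Site 2), Λ ⊆ rectWindow a b → ∀ X : FermionOp Λ, Commute X totalNumber →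
      ∀ D : TWDatum t U (rectWindow a b) Λ X, 0 ≤ D.row ρ := by
    intro Λ hΛW X hXN D
    have hInjΛ1 : Set.InjOn (Torus.proj (d := 2) L) ↑(thicken Λ 1) :=
      (hInjBox Λ hΛW).mono (by exact_mod_cast subset_thicken (thicken Λ 1) 1)
    -- each relocated piece has the torus expectation of the un-relocated piece (translation invariance of `ω`)
    have hpiece : ∀ k, (ρ * fermionEmbed ((PolySite.shiftEmb (D.v k) (D.S k)).trans (PolySite.incl (D.hv k)))
        (D.B k)).trace = ω (fermionEmbed (PolySite.toTorusEmb L (hInjΛ1.mono (by exact_mod_cast D.hS k))) (D.B k)) := by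
      intro k
      rw [hρdef, trace_densityOfFun_mul, hφ, ← fermionEmbed_fermionEmbed, fermionEmbed_toTorusEmb_incl (D.hv k) hWinj,
        fermionEmbed_toTorusEmb_shiftEmb L (D.v k) (hInjΛ1.mono (by exact_mod_cast D.hS k)) _ (D.B k), hconjT]
    -- the pieces reassemble on the torus
    have hsum : D.row ρ = ω (fermionEmbed (PolySite.toTorusEmb L hInjΛ1) (stabilityObs t U Λ X)) := by
      unfold TWDatum.row
      rw [← D.sum_eq, map_sum, map_sum]
      refine Finset.sum_congr rfl fun k _ => ?_
      rw [hpiece, fermionEmbed_toTorusEmb_incl (D.hS k) hInjΛ1]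
    rw [hsum]
    exact htail Λ hΛW X hXN
  have hstabD4 : ∀ Λ : Finset (Site 2), Λ ⊆ rectWindow a b → ∀ X : FermionOp Λ, Commute X totalNumber →
      ∀ D : TWDatumD4 t U (rectWindow a b) Λ X, 0 ≤ D.row ρ := by
    intro Λ hΛW X hXN D
    have hInjΛ1 : Set.InjOn (Torus.proj (d := 2) L) ↑(thicken Λ 1) :=
      (hInjBox Λ hΛW).mono (by exact_mod_cast subset_thicken (thicken Λ 1) 1)
    have hpiece : ∀ k, (ρ * fermionEmbed ((PolySite.d4Emb (D.γ k) (D.v k) (D.S k)).trans (PolySite.incl (D.hv k)))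
        (D.B k)).trace = ω (fermionEmbed (PolySite.toTorusEmb L (hInjΛ1.mono (by exact_mod_cast D.hS k))) (D.B k)) := by
      intro k
      rw [hρdef, trace_densityOfFun_mul, hφ, ← fermionEmbed_fermionEmbed, fermionEmbed_toTorusEmb_incl (D.hv k) hWinj,
        fermionEmbed_toTorusEmb_d4Emb (D.γ k) (D.v k) (hInjΛ1.mono (by exact_mod_cast D.hS k)) _ (D.B k), hconjD]
    have hsum : D.row ρ = ω (fermionEmbed (PolySite.toTorusEmb L hInjΛ1) (stabilityObs t U Λ X)) := by
      unfold TWDatumD4.row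
      rw [← D.sum_eq, map_sum, map_sum]
      refine Finset.sum_congr rfl fun k _ => ?_
      rw [hpiece, fermionEmbed_toTorusEmb_incl (D.hS k) hInjΛ1]
    rw [hsum]
    exact htail Λ hΛW X hXN
  -- (8) the objective: `Tr ρ h_avg = u + h_0 + h_1 = ω(Γ(ι) E_Φ) = E₀ / L²`
  have hbond : ∀ i : Fin 2, wBond ρ t U hpair i = wBond ρp t U hpair' i := by
    intro i
    rw [wBond, wBond, wfun_apply, wfun_apply, hρdef, hρpdef, trace_densityOfFun_mul, trace_densityOfFun_mul, hφ, hφp,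
      fermionEmbed_toTorusEmb_incl, fermionEmbed_toTorusEmb_incl]
  have hsite : wSite ρ t U hpair = wSite ρp t U hpair' := by
    rw [wSite, wSite, wfun_apply, wfun_apply, hρdef, hρpdef, trace_densityOfFun_mul, trace_densityOfFun_mul, hφ, hφp,
      fermionEmbed_toTorusEmb_incl, fermionEmbed_toTorusEmb_incl]
  have hEp : wSite ρp t U hpair' + ∑ i : Fin 2, wBond ρp t U hpair' i =
      ((E : ℝ) : ℂ) / (Fintype.card (TorusSite 2 L) : ℂ) := by
    rw [← hρpLTI.wfun_meanEnergyObs t U hth hpair', wfun_apply, hρpdef, trace_densityOfFun_mul, hφp,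
      fermionEmbed_toTorusEmb_incl]
    exact hE
  have hobj : (ρ * hAvg t U a b).trace = wSite ρ t U hpair + ∑ i : Fin 2, wBond ρ t U hpair i := by
    rw [trace_mul_eq_wfun, hAvg, hρLTI.wfun_clusterHamiltonian t U hpair (subset_refl _), Fin.sum_univ_two,
      Fin.sum_univ_two, bondWeightSum_avgBond_zero ha (by omega), bondWeightSum_avgBond_one (by omega) hb,
      siteWeightSum_avgSite (by omega) (by omega), siteWeightSum_zero]
    simp only [Complex.ofReal_one, one_mul, Complex.ofReal_zero, zero_mul, add_zero]
    ring
  -- (9) apply the node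
  have key := h ρ hρpsd hρtr hρLTI hdens hspin hcomm hflip hsu2 hp4m hstab hstabTW hstabD4
  rw [hobj, hsite] at key
  simp only [hbond] at key
  rw [hEp, Literature.MathematicalPhysics.QuantumLattice.card_torusSite] at key
  have e : ((E : ℝ) : ℂ) / ((L ^ 2 : ℕ) : ℂ) = ((E / (L : ℝ) ^ 2 : ℝ) : ℂ) := by
    push_cast
    rfl
  rw [e, Complex.ofReal_re] at key
  exact key

/-- **`LTIRectSymGSNodeTW` (hence `LTIRectSymGSNode`, `LTIRectSymNode`) bounds the ground-state energy of every
`L × L` torus, in every particle-number sector.**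
For `L ≥ 3`, `a + 1 ≤ L`, `b + 1 ≤ L`, `a, b ≥ 2`, `N ≤ 2L²`: if `lo ≤ Re Tr ρ h_avg` for every window variable
satisfying the rows of `LTIRectSymNode t U a b (N/L²)`, then `lo ≤ E₀(torus L, N) / L²`.  The honest feasible point is
the window density matrix of the TRACIAL ground state `ω_P = Tr(P ·)/Tr P` of the `N`-particle sector (all `S^z`:
`P` = the orthogonal projection onto the lowest eigenspace of `H` in `nParticleSubmodule N`) pulled back along
`Γ(ι_{W,L})`: PSD / trace one (`projState_nonneg/_one`); LTI, `p4m` and spin-flip rows (`P` commutes with the affine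
`D₄` unitaries `U_w D_γ` and with `U_swap`: `sectorGroundProj_commute`, `d4Affine_*`, `relabel_spinSwap_hamiltonian`,
`fermionEmbed_toTorusEmb_shiftEmb/_d4Emb`, `fermionEmbed_relabel_spinSwap`); block rows and `SU(2)` rows (`P`
commutes with `N_σ` and with `S⁺`: `hamiltonian_commute_spinPlus`, `sum_numberOp/spinPlus_commutator_fermionEmbed`);
densities (`ω(N̂) = N`, `ω(N_↑) = ω(N_↓)` by the spin exchange, `ω(n_{xσ}) = ω(N_σ)/L²` by translations); objective
`= E₀(N)/L²` (`sum_relabel_translate_hubbard_meanEnergyObs`, `groundEnergy_eq_minEnergyOn` + the §5/§7.2 bookkeeping);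
stability rows, plain (`Λ⁺ ⊆ W`) and TERM-WISE RELOCATED (§6b: `Λ ⊆ W`, translation or affine-`D₄` data; each
relocated piece has the torus expectation of the un-relocated one, `fermionEmbed_toTorusEmb_shiftEmb/_d4Emb`, and the
pieces reassemble to `Γ(Ãᴴ[H_{Λ⁺}, Ã])`): `ω_P(B̃ᴴ[H_L, B̃]) ≥ 0` for `B̃` preserving the sector
(`hubbardTorus_commutator_fermionEmbed`, `projState_sectorGroundProj_stability_nonneg`). -/
theorem LTIRectSymGSNodeTW.le_groundEnergyAt_div (t U : ℝ) (hL : 3 ≤ L) {a b : ℕ} (ha : 2 ≤ a) (hb : 2 ≤ b)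
    (habL : a + b + 3 ≤ L) {N : ℕ} (hN : N ≤ 2 * L ^ 2) {lo : ℝ}
    (h : LTIRectSymGSNodeTW t U a b ((N : ℝ) / (L : ℝ) ^ 2) lo) :
    lo ≤ groundEnergyAt (fermionTorusGraph 2 L) t U N / (L : ℝ) ^ 2 := by
  have hEq : (hubbardTorus 2 L t U).minEnergyOn (nParticleSubmodule (ι := Orb (FermionTorus 2 L)) N) =
      groundEnergyAt (fermionTorusGraph 2 L) t U N :=
    (groundEnergy_eq_minEnergyOn (hubbardTorus 2 L t U) N _ fun ψ => Iff.rfl).symm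
  rw [← hEq]
  exact h.le_div_of_isSymTorusState t U hL ha hb habL (isSymTorusState_sectorGround t U hL hN)

/-- … in particular the symmetric ground-state-class node (plain stability rows only). -/
theorem LTIRectSymGSNode.le_groundEnergyAt_div (t U : ℝ) (hL : 3 ≤ L) {a b : ℕ} (ha : 2 ≤ a) (hb : 2 ≤ b)
    (habL : a + b + 3 ≤ L) {N : ℕ} (hN : N ≤ 2 * L ^ 2) {lo : ℝ}
    (h : LTIRectSymGSNode t U a b ((N : ℝ) / (L : ℝ) ^ 2) lo) :
    lo ≤ groundEnergyAt (fermionTorusGraph 2 L) t U N / (L : ℝ) ^ 2 :=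
  h.tw.le_groundEnergyAt_div t U hL ha hb habL hN

/-- … in particular the symmetric node (no stability rows) bounds every torus sector energy. -/
theorem LTIRectSymNode.le_groundEnergyAt_div (t U : ℝ) (hL : 3 ≤ L) {a b : ℕ} (ha : 2 ≤ a) (hb : 2 ≤ b)
    (habL : a + b + 3 ≤ L) {N : ℕ} (hN : N ≤ 2 * L ^ 2) {lo : ℝ}
    (h : LTIRectSymNode t U a b ((N : ℝ) / (L : ℝ) ^ 2) lo) :
    lo ≤ groundEnergyAt (fermionTorusGraph 2 L) t U N / (L : ℝ) ^ 2 :=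
  h.symGSNode.le_groundEnergyAt_div t U hL ha hb habL hN

end SymTransport

end Summit.Ventures.CertifiedManyBodySolver.Rows.RectMarginalNodes

end
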